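import Literature.RepresentationTheory.CompactGroups.CharacterProjection
import Literature.NumberTheory.Automorphic.CompactGroupKFiniteVectorsPeterWeyl
import Literature.NumberTheory.Automorphic.HilbertRepIsotypicComponent
import HarnessLib

/-!
# The character projector is the orthogonal projection onto the isotypic component (compact groups)

Topic `NumberTheory/Automorphic` (the Hilbert-space representation vocabulary of `HilbertRepSpectrum` /
`HilbertRepIsotypicComponent`: `IsUnitary`, `IsStronglyContinuous`, `ClosedSubrep`, `IsTopIrreducible`,
`AreUnitarilyEquivalent`, `isotypicComponent`) joined to `RepresentationTheory/CompactGroups/CharacterProjection`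
(`Schur.charProj μ τ π v = dim τ • ∫ conj χ_τ(g) • π g v dμ`).  Theorems only; no definition, no named fact.

**Bröcker–tom Dieck, *Representations of Compact Lie Groups* (GTM 98, 1985), III Thm. (5.10) (i), (iv)** (PDF p. 135):
for a unitary representation of the compact group `G` on a Hilbert space `H` and an irreducible character `χ`,
`P_χ : v ↦ e_χ * v` is the (orthogonal) projection of `H` onto the isotypic part `H_χ`, the closure of the sum of
the irreducible subrepresentations with character `χ`; equivalently **Deitmar–Echterhoff, *Principles of Harmonic
Analysis* (2nd ed. 2014), Prop. 7.3.3**: the orthogonal projection onto the isotype `V_π(τ)` is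
`dim τ · ∫_K conj χ_τ(k) π(k) dk`.

Proof (from the operator calculus of `CharacterProjection` and the tree's spectral vocabulary rather than the book's
`C*`-idempotents): `P_τ` (`Schur.charProjL`) and the orthogonal projection `P_N` onto `N = π.isotypicComponent τ` are
bounded, so it suffices to compare them on the irreducible closed subrepresentations `W` of `π`, whose span is dense
for compact `G` (`discretePart_eq_top_of_compactSpace`, III (5.10)(iii)).  Such a `W` is finite-dimensional
(III (5.8)); if `W ≃ τ` (unitarily) then `W ≤ N` and `P_τ = id` on `W` (`Schur.charProj_apply_of_comm`,
II (4.16)(iv)); otherwise `W ⟂ N` (`isotypicComponent_le_orthogonal`, Deitmar–Echterhoff Cor. 6.1.9) and `P_τ = 0`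
on `W` (`Schur.charProj_apply_of_comm_eq_zero`, II (4.6)) — using that an algebraic equivalence between `τ` and the
unitary `W` can be normalised to a unitary one (`IsTopIrreducible.exists_norm_map_eq_mul`, Cor. 6.1.9).

* `isTopIrreducible_of_isIrreducible`, `isIrreducible_of_isTopIrreducible` — in finite dimension topological and
  algebraic irreducibility agree (all subspaces are closed);
* `areUnitarilyEquivalent_toContRep_of_equiv` — an algebraic equivalence from the irreducible unitary
  finite-dimensional `τ` onto a closed subrepresentation of the unitary `π` yields a unitary equivalence;
* `charProj_eq_self_of_mem_closedSubrep`, `charProj_eq_zero_of_mem_closedSubrep` — `P_τ = id` on the members of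
  the class of `τ`, `P_τ = 0` on the irreducible closed subrepresentations of the other classes;
* `charProj_eq_starProjection_isotypicComponent` — **III Thm. (5.10)(i)/(iv), Deitmar–Echterhoff Prop. 7.3.3**:
  `P_τ v = (π.isotypicComponent τ).starProjection v`; corollaries `charProj_mem_isotypicComponent`,
  `charProj_eq_self_iff_mem_isotypicComponent`, `charProj_charProj` (idempotence),
  `charProj_eq_zero_iff_mem_orthogonal`, `charProj_charProj_eq_zero` (**III (5.10)(ii)**: `P_τ P_σ = 0` for
  `σ ≄ τ`).

## References
* T. Bröcker, T. tom Dieck, *Representations of Compact Lie Groups*, GTM 98 (1985), III (5.8), Thm. (5.10), PDF p. 135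
  [BrockerTomDieck1985].
* A. Deitmar, S. Echterhoff, *Principles of Harmonic Analysis*, 2nd ed. (2014), Lemma 6.1.7, Cor. 6.1.9, §7.3,
  Prop. 7.3.3 [DeitmarEchterhoff2014].

## Provenance
Lane `lit-hodgefound` (HOME `run/shared/lean/pub/lit-hodgefound/`), prover seat `lit-hodgefound-p05` generation 6 (Layer 0:
compact groups — isotypic projectors / multiplicities of `K`-types).
-/

noncomputable section

open MeasureTheory Complex ContRepresentation
open Literature.RepresentationTheory.CompactGroups
open scoped InnerProductSpace ComplexConjugate

namespace Literature.NumberTheory.Automorphic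

/-! ### Finite dimension: topological = algebraic irreducibility -/

section FiniteDim

variable {G : Type*} [Group G]
variable {E : Type*} [NormedAddCommGroup E] [InnerProductSpace ℂ E] [FiniteDimensional ℂ E]

omit [FiniteDimensional ℂ E] in
/-- An algebraically irreducible representation is topologically irreducible. [cite: DeitmarEchterhoff2014, Lemma 6.1.7] -/
theorem isTopIrreducible_of_isIrreducible (τ : ContRepresentation ℂ G E) [hirr : τ.toRepresentation.IsIrreducible] :
    τ.IsTopIrreducible := by
  rw [ContRepresentation.isTopIrreducible_iff]
  haveI : Nontrivial E := IsSimpleModule.nontrivial (MonoidAlgebra ℂ G) τ.toRepresentation.asModule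
  refine ⟨inferInstance, fun W => ?_⟩
  rcases hirr.eq_bot_or_eq_top W.toSubrepresentation with h | h
  · exact Or.inl (ClosedSubrep.toSubrepresentation_injective h)
  · exact Or.inr (ClosedSubrep.toSubrepresentation_injective h)

/-- In finite dimension a topologically irreducible representation is algebraically irreducible (every subspace is
closed, Mathlib `Submodule.closed_of_finiteDimensional`). [cite: DeitmarEchterhoff2014, Lemma 6.1.7] -/
theorem isIrreducible_of_isTopIrreducible (τ : ContRepresentation ℂ G E) (hirr : τ.IsTopIrreducible) :
    τ.toRepresentation.IsIrreducible := by
  obtain ⟨hnt, hall⟩ := (ContRepresentation.isTopIrreducible_iff τ).mp hirr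
  haveI : Nontrivial (Subrepresentation τ.toRepresentation) :=
    ⟨⟨⊥, ⊤, fun hbt => bot_ne_top (congrArg Subrepresentation.toSubmodule hbt : (⊥ : Submodule ℂ E) = ⊤)⟩⟩
  refine ⟨fun ρ' => ?_⟩
  rcases hall ⟨ρ', ρ'.toSubmodule.closed_of_finiteDimensional⟩ with h | h
  · exact Or.inl (congrArg ClosedSubrep.toSubrepresentation h)
  · exact Or.inr (congrArg ClosedSubrep.toSubrepresentation h)

end FiniteDim

/-! ### The character projector on the irreducible closed subrepresentations -/

section Main

variable {G : Type*} [TopologicalSpace G] [Group G] [IsTopologicalGroup G] [MeasurableSpace G] [BorelSpace G]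
  [CompactSpace G] [T2Space G]
variable {H : Type*} [NormedAddCommGroup H] [InnerProductSpace ℂ H] [CompleteSpace H]
variable {E : Type*} [NormedAddCommGroup E] [InnerProductSpace ℂ E] [FiniteDimensional ℂ E]
variable {π : ContRepresentation ℂ G H} {τ : ContRepresentation ℂ G E}
variable (μ : Measure G) [IsProbabilityMeasure μ] [μ.IsMulLeftInvariant]

omit [TopologicalSpace G] [IsTopologicalGroup G] [MeasurableSpace G] [BorelSpace G] [CompactSpace G] [T2Space G] in
/-- **Algebraic equivalence onto a closed subrepresentation of a unitary representation is unitary equivalence**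
(for an irreducible unitary finite-dimensional `τ`): an equivalence `e : τ ≃ W` is a non-zero bounded intertwiner
out of an irreducible unitary representation, so `‖e v‖ = r ‖v‖` with `r > 0`
(`IsTopIrreducible.exists_norm_map_eq_mul`) and `r⁻¹ e` is an isometric intertwiner onto `W`.
[cite: DeitmarEchterhoff2014, Cor. 6.1.9] -/
theorem areUnitarilyEquivalent_toContRep_of_equiv (hπu : π.IsUnitary) (W : ClosedSubrep π)
    [τ.toRepresentation.IsIrreducible] (hτu : ∀ (g : G) (v w : E), ⟪τ g v, τ g w⟫_ℂ = ⟪v, w⟫_ℂ)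
    (e : τ.toRepresentation.Equiv W.toContRep.toRepresentation) : AreUnitarilyEquivalent W.toContRep τ := by
  haveI : CompleteSpace E := FiniteDimensional.complete ℂ E
  haveI : Nontrivial E := IsSimpleModule.nontrivial (MonoidAlgebra ℂ G) τ.toRepresentation.asModule
  have hτU : τ.IsUnitary := ContRepresentation.isUnitary_iff_inner_map_map.mpr hτu
  -- the equivalence as a bounded intertwiner `τ → W`
  let T : E →L[ℂ] W.toSubmodule := LinearMap.toContinuousLinearMap e.toLinearEquiv.toLinearMap
  have hT_apply : ∀ v, T v = e v := fun v => rfl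
  have hT : ∀ g : G, T ∘L τ g = W.toContRep g ∘L T := fun g => by
    refine ContinuousLinearMap.ext fun v => ?_
    simp only [ContinuousLinearMap.comp_apply, hT_apply]
    exact e.toIntertwiningMap.isIntertwining _ _ g v
  obtain ⟨r, hr0, hr⟩ :=
    IsTopIrreducible.exists_norm_map_eq_mul (isTopIrreducible_of_isIrreducible τ) hτU (hπu.toContRep W) hT
  have hrpos : 0 < r := by
    obtain ⟨v, hv⟩ := exists_ne (0 : E)
    rcases hr0.lt_or_eq with h | h
    · exact h
    · exfalso
      have h1 := hr v
      rw [← h, zero_mul, norm_eq_zero, hT_apply] at h1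
      exact hv (e.toLinearEquiv.map_eq_zero_iff.mp h1)
  -- the isometry `U = r⁻¹ e : E → H`
  let U : E →ₗᵢ[ℂ] H :=
    { toLinearMap := ((r⁻¹ : ℝ) : ℂ) • ((W.toSubmodule.subtypeL ∘L T : E →L[ℂ] H) : E →ₗ[ℂ] H)
      norm_map' := fun v => by
        change ‖((r⁻¹ : ℝ) : ℂ) • (T v : H)‖ = ‖v‖
        rw [norm_smul, Complex.norm_real, Real.norm_eq_abs, abs_of_nonneg (inv_nonneg.mpr hr0),
          Submodule.norm_coe, hr v, ← mul_assoc, inv_mul_cancel₀ hrpos.ne', one_mul] }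
  have hUapply : ∀ v : E, U v = ((r⁻¹ : ℝ) : ℂ) • (T v : H) := fun v => rfl
  have hU : ∀ (g : G) (v : E), U (τ g v) = π g (U v) := by
    intro g v
    have h := congrArg (fun f : E →L[ℂ] W.toSubmodule => (f v : H)) (hT g)
    simp only [ContinuousLinearMap.coe_comp, Function.comp_apply] at h
    rw [hUapply, hUapply, h, map_smul]
    rfl
  -- its range is `W` (as `e` is onto `W`)
  have hW₁ : ClosedSubrep.ofLinearIsometry U hU = W := by
    ext x
    rw [ClosedSubrep.mem_ofLinearIsometry]
    constructor
    · rintro ⟨v, rfl⟩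
      rw [hUapply]
      exact W.toSubmodule.smul_mem _ (T v).2
    · intro hx
      refine ⟨((r : ℝ) : ℂ) • e.symm ⟨x, hx⟩, ?_⟩
      rw [hUapply, map_smul, hT_apply]
      have hee : e (e.symm ⟨x, hx⟩) = ⟨x, hx⟩ := e.apply_symm_apply ⟨x, hx⟩
      rw [hee, Submodule.coe_smul, smul_smul, ← Complex.ofReal_mul, inv_mul_cancel₀ hrpos.ne', Complex.ofReal_one,
        one_smul]
  have h : AreUnitarilyEquivalent τ (ClosedSubrep.ofLinearIsometry U hU).toContRep := by
    refine ⟨ClosedSubrep.equivOfLinearIsometry U hU, ?_⟩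
    refine AddMonoidHomClass.isometry_of_norm _ fun v => ?_
    rw [← U.norm_map v]
    rfl
  rw [hW₁] at h
  exact h.symm

omit [T2Space G] in
/-- **`P_τ` is the identity on every irreducible closed subrepresentation unitarily equivalent to `τ`**
(Bröcker–tom Dieck III (5.10)(i): `P_χ` fixes the irreducible subspaces with character `χ`; via
`Schur.charProj_apply_of_comm` applied to the intertwiner `E ≃ W ↪ H`). [cite: BrockerTomDieck1985, III Thm (5.10)] -/
theorem charProj_eq_self_of_mem_closedSubrep (hτ : Continuous (τ : G → E →L[ℂ] E))
    [τ.toRepresentation.IsIrreducible] (hτu : ∀ (g : G) (v w : E), ⟪τ g v, τ g w⟫_ℂ = ⟪v, w⟫_ℂ)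
    (W : ClosedSubrep π) (hW : AreUnitarilyEquivalent W.toContRep τ) {v : H} (hv : v ∈ W) :
    Schur.charProj μ τ π v = v := by
  obtain ⟨e, -⟩ := hW
  -- the intertwiner `T : E ≃ W ↪ H`
  let T : E →L[ℂ] H := W.toSubmodule.subtypeL ∘L e.symm.toContinuousLinearEquiv.toContinuousLinearMap
  have hT_apply : ∀ x : E, T x = (e.symm x : H) := fun x => rfl
  have hT : ∀ g : G, (π g).comp T = T.comp (τ g) := fun g => by
    refine ContinuousLinearMap.ext fun x => ?_
    have h := congrArg (fun f : E →L[ℂ] W.toSubmodule => (f x : H)) (e.symm.isIntertwining g)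
    simp only [ContinuousLinearMap.coe_comp, Function.comp_apply, ClosedSubrep.coe_toContRep_apply] at h
    simp only [ContinuousLinearMap.comp_apply, hT_apply]
    exact h.symm
  have hv' : v = T (e ⟨v, hv⟩) := by
    rw [hT_apply]
    have h : e.symm (e ⟨v, hv⟩) = ⟨v, hv⟩ := e.toContinuousLinearEquiv.symm_apply_apply ⟨v, hv⟩
    rw [h]
  rw [hv']
  exact Schur.charProj_apply_of_comm μ hτ hτu T hT _

/-- **`P_τ` vanishes on every irreducible closed subrepresentation NOT unitarily equivalent to `τ`** (Bröcker–tom Dieck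
III (5.10)(i) with II (4.6); `Schur.charProj_apply_of_comm_eq_zero` applied to the inclusion `W ↪ H`, the
restricted representation being finite-dimensional (III (5.8)), irreducible and algebraically inequivalent to `τ` by
`areUnitarilyEquivalent_toContRep_of_equiv`). [cite: BrockerTomDieck1985, III Thm (5.10)] -/
theorem charProj_eq_zero_of_mem_closedSubrep (hπc : π.IsStronglyContinuous) (hπu : π.IsUnitary)
    (hτ : Continuous (τ : G → E →L[ℂ] E)) [τ.toRepresentation.IsIrreducible]
    (hτu : ∀ (g : G) (v w : E), ⟪τ g v, τ g w⟫_ℂ = ⟪v, w⟫_ℂ) (W : ClosedSubrep π)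
    (hWirr : W.toContRep.IsTopIrreducible) (hW : ¬ AreUnitarilyEquivalent W.toContRep τ) {v : H} (hv : v ∈ W) :
    Schur.charProj μ τ π v = 0 := by
  haveI : FiniteDimensional ℂ W.toSubmodule := finiteDimensional_of_isTopIrreducible_toContRep hπc hWirr
  haveI : W.toContRep.toRepresentation.IsIrreducible := isIrreducible_of_isTopIrreducible _ hWirr
  have hσ : Continuous (W.toContRep : G → W.toSubmodule →L[ℂ] W.toSubmodule) :=
    Schur.continuous_of_forall_continuous_apply fun w =>
      (isStronglyContinuous_toContRep_of_isStronglyContinuous hπc W) w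
  have hne : IsEmpty (τ.toRepresentation.Equiv W.toContRep.toRepresentation) :=
    ⟨fun e => hW (areUnitarilyEquivalent_toContRep_of_equiv hπu W hτu e)⟩
  have hS : ∀ g : G, (π g).comp W.toSubmodule.subtypeL = W.toSubmodule.subtypeL.comp (W.toContRep g) :=
    fun g => ContinuousLinearMap.ext fun w => rfl
  exact Schur.charProj_apply_of_comm_eq_zero μ hτ hσ hne hτu W.toSubmodule.subtypeL hS ⟨v, hv⟩

/-! ### The main theorem -/

/-- **Bröcker–tom Dieck III Thm. (5.10) (i)/(iv); Deitmar–Echterhoff Prop. 7.3.3 — the character projector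
`P_τ = dim τ · ∫ conj χ_τ(g) π(g) dμ` IS the orthogonal projection onto the `τ`-isotypic component** of a unitary
strongly continuous representation `π` of a compact (Hausdorff) group on a Hilbert space (`τ` irreducible unitary,
`μ` a left-invariant probability measure). [cite: BrockerTomDieck1985, III Thm (5.10)]
[cite: DeitmarEchterhoff2014, Prop. 7.3.3] -/
theorem charProj_eq_starProjection_isotypicComponent (hπc : π.IsStronglyContinuous) (hπu : π.IsUnitary)
    (hτ : Continuous (τ : G → E →L[ℂ] E)) [τ.toRepresentation.IsIrreducible]
    (hτu : ∀ (g : G) (v w : E), ⟪τ g v, τ g w⟫_ℂ = ⟪v, w⟫_ℂ) (v : H) :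
    Schur.charProj μ τ π v = (π.isotypicComponent τ).toSubmodule.starProjection v := by
  set N : ClosedSubrep π := π.isotypicComponent τ with hN
  let P : H →L[ℂ] H := Schur.charProjL μ τ π hτ hτu (fun v => hπc v) (fun g v w => hπu.inner_map_map g v w)
  let Q : H →L[ℂ] H := N.toSubmodule.starProjection
  -- the (closed) subspace where the two bounded operators agree
  let D : Submodule ℂ H := LinearMap.ker ((P : H →ₗ[ℂ] H) - (Q : H →ₗ[ℂ] H))
  have hD_mem : ∀ x : H, x ∈ D ↔ Schur.charProj μ τ π x = Q x := fun x => by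
    simp only [D, LinearMap.mem_ker, LinearMap.sub_apply, ContinuousLinearMap.coe_coe, sub_eq_zero, P,
      Schur.charProjL_apply]
  have hD : IsClosed (D : Set H) := by
    have h : (D : Set H) = {x | P x = Q x} := by
      ext x
      simp only [SetLike.mem_coe, hD_mem, Set.mem_setOf_eq, P, Schur.charProjL_apply]
    rw [h]
    exact isClosed_eq P.continuous Q.continuous
  -- every irreducible closed subrepresentation lies in `D`
  have hWD : ∀ W : ClosedSubrep π, W.toContRep.IsTopIrreducible → W.toSubmodule ≤ D := by
    intro W hW x hx
    rw [hD_mem]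
    by_cases heq : AreUnitarilyEquivalent W.toContRep τ
    · -- a member of the class of `τ`: `W ≤ N`, both operators fix `x`
      have hxN : x ∈ N.toSubmodule := le_isotypicComponent hW heq hx
      rw [Submodule.starProjection_eq_self_iff.mpr hxN]
      exact charProj_eq_self_of_mem_closedSubrep μ hτ hτu W heq hx
    · -- another class: `W ⟂ N`, both operators kill `x`
      have h1 : W ≤ π.isotypicComponent W.toContRep := le_isotypicComponent hW (AreUnitarilyEquivalent.refl _)
      have h2 : π.isotypicComponent W.toContRep ≤ N.orthogonal hπu := isotypicComponent_le_orthogonal hπu heq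
      have hxN : x ∈ N.toSubmoduleᗮ := h2 (h1 hx)
      rw [(Submodule.starProjection_apply_eq_zero_iff _).mpr hxN]
      exact charProj_eq_zero_of_mem_closedSubrep μ hπc hπu hτ hτu W hW heq hx
  -- the irreducible closed subrepresentations span a dense subspace (compact `G`)
  have hle : (⨆ W ∈ {W : ClosedSubrep π | W.toContRep.IsTopIrreducible}, (W : ClosedSubrep π).toSubmodule) ≤ D :=
    iSup₂_le fun W hW => hWD W hW
  have htop : (⨆ W ∈ {W : ClosedSubrep π | W.toContRep.IsTopIrreducible},
      (W : ClosedSubrep π).toSubmodule).topologicalClosure = ⊤ :=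
    congrArg (fun Z : ClosedSubrep π => Z.toSubmodule) (discretePart_eq_top_of_compactSpace hπc hπu)
  have hvD : v ∈ D := by
    refine Submodule.topologicalClosure_minimal _ hle hD ?_
    rw [htop]
    exact Submodule.mem_top
  exact (hD_mem v).mp hvD

/-- Hence `P_τ v` lies in the `τ`-isotypic component. [cite: BrockerTomDieck1985, III Thm (5.10)] -/
theorem charProj_mem_isotypicComponent (hπc : π.IsStronglyContinuous) (hπu : π.IsUnitary)
    (hτ : Continuous (τ : G → E →L[ℂ] E)) [τ.toRepresentation.IsIrreducible]
    (hτu : ∀ (g : G) (v w : E), ⟪τ g v, τ g w⟫_ℂ = ⟪v, w⟫_ℂ) (v : H) :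
    Schur.charProj μ τ π v ∈ π.isotypicComponent τ := by
  rw [charProj_eq_starProjection_isotypicComponent μ hπc hπu hτ hτu]
  exact Submodule.starProjection_apply_mem _ v

/-- … `P_τ v = v` iff `v` lies in the `τ`-isotypic component (Bröcker–tom Dieck III (5.10)(iv): `H_χ` is the range
of the projection `P_χ`). [cite: BrockerTomDieck1985, III Thm (5.10)] -/
theorem charProj_eq_self_iff_mem_isotypicComponent (hπc : π.IsStronglyContinuous) (hπu : π.IsUnitary)
    (hτ : Continuous (τ : G → E →L[ℂ] E)) [τ.toRepresentation.IsIrreducible]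
    (hτu : ∀ (g : G) (v w : E), ⟪τ g v, τ g w⟫_ℂ = ⟪v, w⟫_ℂ) (v : H) :
    Schur.charProj μ τ π v = v ↔ v ∈ π.isotypicComponent τ := by
  rw [charProj_eq_starProjection_isotypicComponent μ hπc hπu hτ hτu, Submodule.starProjection_eq_self_iff]
  rfl

/-- … and `P_τ` is idempotent. [cite: BrockerTomDieck1985, III Thm (5.10)] -/
theorem charProj_charProj (hπc : π.IsStronglyContinuous) (hπu : π.IsUnitary)
    (hτ : Continuous (τ : G → E →L[ℂ] E)) [τ.toRepresentation.IsIrreducible]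
    (hτu : ∀ (g : G) (v w : E), ⟪τ g v, τ g w⟫_ℂ = ⟪v, w⟫_ℂ) (v : H) :
    Schur.charProj μ τ π (Schur.charProj μ τ π v) = Schur.charProj μ τ π v :=
  (charProj_eq_self_iff_mem_isotypicComponent μ hπc hπu hτ hτu _).mpr
    (charProj_mem_isotypicComponent μ hπc hπu hτ hτu v)

/-- … `P_τ v = 0` iff `v` is orthogonal to the `τ`-isotypic component. [cite: BrockerTomDieck1985, III Thm (5.10)] -/
theorem charProj_eq_zero_iff_mem_orthogonal (hπc : π.IsStronglyContinuous) (hπu : π.IsUnitary)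
    (hτ : Continuous (τ : G → E →L[ℂ] E)) [τ.toRepresentation.IsIrreducible]
    (hτu : ∀ (g : G) (v w : E), ⟪τ g v, τ g w⟫_ℂ = ⟪v, w⟫_ℂ) (v : H) :
    Schur.charProj μ τ π v = 0 ↔ v ∈ (π.isotypicComponent τ).orthogonal hπu := by
  rw [charProj_eq_starProjection_isotypicComponent μ hπc hπu hτ hτu, Submodule.starProjection_apply_eq_zero_iff]
  rfl

/-- **`P_τ P_σ = 0` for inequivalent irreducible `τ`, `σ`** (Bröcker–tom Dieck III (5.10)(ii): the isotypic parts of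
distinct classes are orthogonal — in the tree `isotypicComponent_le_orthogonal`). [cite: BrockerTomDieck1985, III Thm (5.10)] -/
theorem charProj_charProj_eq_zero {F : Type*} [NormedAddCommGroup F] [InnerProductSpace ℂ F] [FiniteDimensional ℂ F]
    {σ : ContRepresentation ℂ G F} (hπc : π.IsStronglyContinuous) (hπu : π.IsUnitary)
    (hτ : Continuous (τ : G → E →L[ℂ] E)) [τ.toRepresentation.IsIrreducible]
    (hτu : ∀ (g : G) (v w : E), ⟪τ g v, τ g w⟫_ℂ = ⟪v, w⟫_ℂ)
    (hσ : Continuous (σ : G → F →L[ℂ] F)) [σ.toRepresentation.IsIrreducible]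
    (hσu : ∀ (g : G) (v w : F), ⟪σ g v, σ g w⟫_ℂ = ⟪v, w⟫_ℂ) (hne : ¬ AreUnitarilyEquivalent σ τ) (v : H) :
    Schur.charProj μ τ π (Schur.charProj μ σ π v) = 0 := by
  rw [charProj_eq_zero_iff_mem_orthogonal μ hπc hπu hτ hτu]
  exact isotypicComponent_le_orthogonal hπu hne (charProj_mem_isotypicComponent μ hπc hπu hσ hσu v)

end Main

end Literature.NumberTheory.Automorphic
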